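import Mathlib
import Summits.MatrixMultiplication.MatrixMultiplication.Theorems.SoloBlindFlatWrapper

/-!
# Flat certificate, four letters, mode K — chunks 2, 3 of 7

`native_decide` evaluations of `soloBlindFlatCertCanon 4 7 i 56 false` (every admissible canonical
sub-family of `range 16` with family code `≡ i (mod 7)` is accepted by the K♭ checker in mode K at
scale `56`).  Assembled in `SoloBlindKFlatCorankFour`.  Computational.
-/

namespace Summit.MatrixMultiplication.MatrixMultiplication.Theorems

/-- Flat certificate, four letters, mode K, chunk `2` of `7`. -/
theorem soloBlind_flatCert_four_K_2 : soloBlindFlatCertCanon 4 7 2 56 false = true := by native_decide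

/-- Flat certificate, four letters, mode K, chunk `3` of `7`. -/
theorem soloBlind_flatCert_four_K_3 : soloBlindFlatCertCanon 4 7 3 56 false = true := by native_decide

end Summit.MatrixMultiplication.MatrixMultiplication.Theorems
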